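import Mathlib
import Summits.PneNP.PneNP.Theorems.OverlapGapAlgebraSearchHardWindowLipschitzRungVariance

/-!
# PneNP / OverlapGapAlgebra — crux `SolvableImpliesStableSection` (stmt-PneNP-2463):
# the TYPICALLY-Lipschitz transfer (1/2) — variance with an exceptional set

Support for crux `stmt-PneNP-2463` (`Summit.PneNP.PneNP.Theses.OverlapGapAlgebra.SolvableImpliesStableSection`).
The Lipschitz transfer (`sissLip_solvableImpliesStableSection_of_lipschitz`) asks the solver's section to
be `s`-Lipschitz at EVERY instance. Natural stable algorithms — radius-`r` local rules on the factor
graph, message passing with `O(1)` rounds — are Lipschitz only where the instance is locally sparse: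
their Lipschitz constant is polynomial in the maximum clause-degree, which is `O(log n)` typically but
`m` at worst. This file re-does the Efron–Stein variance bound of the violated-clause count for maps that
are `s`-Lipschitz only at instances of maximum clause-degree `≤ L + 1`, charging the exceptional
instances (`max clause-degree > L`) the trivial bounded difference `m`:

* `sissT_cdeg_update_le`, `sissT_maxdeg_update_le` — a one-clause change raises every clause-degree,
  hence the maximum clause-degree, by at most one;
* `sissT_hamming_clauseUpdate_le` — at an instance of maximum clause-degree `≤ L`, such a map moves by
  at most `k s` under the replacement of a whole clause (the `k`-step literal chain stays at maximum
  clause-degree `≤ L + 1`);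
* `sissT_violated_diff_sq_le_of_hamming` — the bounded difference `(V_g Φ - V_g Φ[a ↦ cl])² ≤ (1 + K·D Φ)²`
  from the single datum `d_H(g Φ, g Φ[a ↦ cl]) ≤ K`;
* `sissT_sum_sq_dev_le` — `∑_Φ (V_g Φ - μ)² ≤ m·(#Inst + k²s²·∑_Φ D(Φ)² + m²·#{Φ : L < D Φ})`.
No new definitions; axioms `propext`, `Classical.choice`, `Quot.sound`.
-/

set_option linter.dupNamespace false -- `Summit.PneNP.PneNP.…`: summit = sub-problem (D-0017)

namespace Summit.PneNP.PneNP.Theorems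

open Finset Filter
open scoped Classical

section TypLipschitz

variable {m k n : ℕ}

/-- A one-clause change raises the clause-degree of every variable by at most one. -/
theorem sissT_cdeg_update_le (Φ : Fin m → Fin k → Fin n × Bool) (a : Fin m) (cl : Fin k → Fin n × Bool)
    (v : Fin n) :
    ((univ : Finset (Fin m)).filter fun i => ∃ j, ((Function.update Φ a cl) i j).1 = v).card
      ≤ ((univ : Finset (Fin m)).filter fun i => ∃ j, (Φ i j).1 = v).card + 1 := by
  have hsub : ((univ : Finset (Fin m)).filter fun i => ∃ j, ((Function.update Φ a cl) i j).1 = v)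
      ⊆ ((univ : Finset (Fin m)).filter fun i => ∃ j, (Φ i j).1 = v) ∪ {a} := by
    intro i hi
    simp only [mem_filter, mem_univ, true_and] at hi
    rw [Finset.mem_union, Finset.mem_singleton]
    by_cases hia : i = a
    · exact Or.inr hia
    · left
      simp only [mem_filter, mem_univ, true_and]
      rwa [Function.update_of_ne hia] at hi
  calc _ ≤ (((univ : Finset (Fin m)).filter fun i => ∃ j, (Φ i j).1 = v) ∪ {a}).card :=
        Finset.card_le_card hsub
    _ ≤ ((univ : Finset (Fin m)).filter fun i => ∃ j, (Φ i j).1 = v).card + ({a} : Finset (Fin m)).card :=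
        Finset.card_union_le _ _
    _ = _ := by rw [Finset.card_singleton]

/-- A one-clause change raises the maximum clause-degree by at most one. -/
theorem sissT_maxdeg_update_le (Φ : Fin m → Fin k → Fin n × Bool) (a : Fin m)
    (cl : Fin k → Fin n × Bool) :
    ((univ : Finset (Fin n)).sup fun v =>
        ((univ : Finset (Fin m)).filter fun i => ∃ j, ((Function.update Φ a cl) i j).1 = v).card)
      ≤ ((univ : Finset (Fin n)).sup fun v =>
          ((univ : Finset (Fin m)).filter fun i => ∃ j, (Φ i j).1 = v).card) + 1 := by
  refine Finset.sup_le fun v _ => ?_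
  calc _ ≤ ((univ : Finset (Fin m)).filter fun i => ∃ j, (Φ i j).1 = v).card + 1 :=
        sissT_cdeg_update_le Φ a cl v
    _ ≤ _ := by
        gcongr
        exact Finset.le_sup (f := fun v => ((univ : Finset (Fin m)).filter
          fun i => ∃ j, (Φ i j).1 = v).card) (mem_univ v)

/-- A whole-clause change is `k` single-literal changes, each a one-clause change of the ORIGINAL
instance: a map that is `s`-Lipschitz (Hamming output, per single-literal change) at every instance of
maximum clause-degree `≤ L + 1` moves by at most `k s` under the replacement of one clause of an
instance of maximum clause-degree `≤ L`. -/
theorem sissT_hamming_clauseUpdate_le (g : (Fin m → Fin k → Fin n × Bool) → (Fin n → Bool)) (s : ℝ)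
    (L : ℕ)
    (hg : ∀ (Φ : Fin m → Fin k → Fin n × Bool),
      ((univ : Finset (Fin n)).sup fun v =>
        ((univ : Finset (Fin m)).filter fun i => ∃ j, (Φ i j).1 = v).card) ≤ L + 1 →
      ∀ (a : Fin m) (b : Fin k) (ℓ : Fin n × Bool),
        (hammingDist (g Φ) (g (Function.update Φ a (Function.update (Φ a) b ℓ))) : ℝ) ≤ s)
    (Φ : Fin m → Fin k → Fin n × Bool)
    (hΦ : ((univ : Finset (Fin n)).sup fun v =>
        ((univ : Finset (Fin m)).filter fun i => ∃ j, (Φ i j).1 = v).card) ≤ L)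
    (a : Fin m) (cl : Fin k → Fin n × Bool) :
    (hammingDist (g Φ) (g (Function.update Φ a cl)) : ℝ) ≤ k * s := by
  -- the chain Φ_t = Φ with the first t literals of clause a replaced
  set P : ℕ → (Fin m → Fin k → Fin n × Bool) := fun t =>
    Function.update Φ a (fun j => if (j : ℕ) < t then cl j else Φ a j) with hP
  have hP0 : P 0 = Φ := by
    simp only [hP, Nat.not_lt_zero, if_false]
    exact Function.update_eq_self a Φ
  have hPk : P k = Function.update Φ a cl := by
    simp only [hP, Fin.is_lt, if_true]
  have hstep : ∀ t : ℕ, ∀ ht : t < k,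
      P (t + 1) = Function.update (P t) a (Function.update ((P t) a) ⟨t, ht⟩ (cl ⟨t, ht⟩)) := by
    intro t ht
    simp only [hP, Function.update_self, Function.update_idem]
    congr 1
    funext j
    by_cases hj : j = ⟨t, ht⟩
    · subst hj
      simp
    · rw [Function.update_of_ne hj]
      have hjt : (j : ℕ) ≠ t := fun h => hj (Fin.ext h)
      by_cases hlt : (j : ℕ) < t
      · simp [hlt, Nat.lt_succ_of_lt hlt]
      · have : ¬ (j : ℕ) < t + 1 := by omega
        simp [hlt, this]
  -- every chain element is a one-clause change of Φ, so has maximum clause-degree ≤ L + 1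
  have hdeg : ∀ t : ℕ, ((univ : Finset (Fin n)).sup fun v =>
      ((univ : Finset (Fin m)).filter fun i => ∃ j, ((P t) i j).1 = v).card) ≤ L + 1 := by
    intro t
    exact (sissT_maxdeg_update_le Φ a _).trans (by omega)
  have hchain : ∀ t : ℕ, t ≤ k → (hammingDist (g Φ) (g (P t)) : ℝ) ≤ t * s := by
    intro t
    induction t with
    | zero => intro _; simp [hP0]
    | succ t ih =>
        intro ht
        have ht' : t < k := Nat.lt_of_succ_le ht
        have h1 := ih ht'.le
        have h2 := hg (P t) (hdeg t) a ⟨t, ht'⟩ (cl ⟨t, ht'⟩)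
        rw [← hstep t ht'] at h2
        have htri : (hammingDist (g Φ) (g (P (t + 1))) : ℝ)
            ≤ hammingDist (g Φ) (g (P t)) + hammingDist (g (P t)) (g (P (t + 1))) := by
          exact_mod_cast hammingDist_triangle (g Φ) (g (P t)) (g (P (t + 1)))
        push_cast
        linarith
  have := hchain k le_rfl
  rwa [hPk] at this

/-- Bounded differences of the violated-clause count under a one-clause change from the single datum
`d_H(g Φ, g Φ[a ↦ cl]) ≤ K` (`0 ≤ K`): `(V_g Φ - V_g (Φ[a ↦ cl]))² ≤ (1 + K · D Φ)²`,
`D Φ = max_v #{i : ∃ j, (Φ i j).1 = v}`. -/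
theorem sissT_violated_diff_sq_le_of_hamming (g : (Fin m → Fin k → Fin n × Bool) → (Fin n → Bool))
    (K : ℝ) (hK : 0 ≤ K) (Φ : Fin m → Fin k → Fin n × Bool) (a : Fin m) (cl : Fin k → Fin n × Bool)
    (hham : (hammingDist (g Φ) (g (Function.update Φ a cl)) : ℝ) ≤ K) :
    ((((univ : Finset (Fin m)).filter fun i => ∀ j, g Φ (Φ i j).1 ≠ (Φ i j).2).card : ℝ)
      - (((univ : Finset (Fin m)).filter fun i =>
          ∀ j, g (Function.update Φ a cl) ((Function.update Φ a cl) i j).1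
            ≠ ((Function.update Φ a cl) i j).2).card : ℝ)) ^ 2
      ≤ (1 + K * ((univ : Finset (Fin n)).sup fun v =>
          ((univ : Finset (Fin m)).filter fun i => ∃ j, (Φ i j).1 = v).card : ℕ)) ^ 2 := by
  set Φ' := Function.update Φ a cl with hΦ'
  set D : ℕ := (univ : Finset (Fin n)).sup fun v =>
      ((univ : Finset (Fin m)).filter fun i => ∃ j, (Φ i j).1 = v).card with hDdef
  have hoff : ∀ i, i ≠ a → Φ i = Φ' i := fun i hi => by rw [hΦ', Function.update_of_ne hi]
  have hoff' : ∀ i, i ≠ a → Φ' i = Φ i := fun i hi => (hoff i hi).symm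
  have hD1 : ∀ v : Fin n, ((univ : Finset (Fin m)).filter fun i => i ≠ a ∧ ∃ j, (Φ i j).1 = v).card ≤ D := by
    intro v
    calc _ ≤ ((univ : Finset (Fin m)).filter fun i => ∃ j, (Φ i j).1 = v).card :=
          Finset.card_le_card (fun i hi => by
            simp only [mem_filter, mem_univ, true_and] at hi ⊢; exact hi.2)
      _ ≤ D := by
          rw [hDdef]
          exact Finset.le_sup (f := fun v => ((univ : Finset (Fin m)).filter
            fun i => ∃ j, (Φ i j).1 = v).card) (mem_univ v)
  have hD2 : ∀ v : Fin n, ((univ : Finset (Fin m)).filter fun i => i ≠ a ∧ ∃ j, (Φ' i j).1 = v).card ≤ D := by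
    intro v
    have : ((univ : Finset (Fin m)).filter fun i => i ≠ a ∧ ∃ j, (Φ' i j).1 = v)
        = ((univ : Finset (Fin m)).filter fun i => i ≠ a ∧ ∃ j, (Φ i j).1 = v) := by
      refine Finset.filter_congr fun i _ => ?_
      constructor
      · rintro ⟨hia, j, hj⟩; exact ⟨hia, j, by rw [← hoff' i hia]; exact hj⟩
      · rintro ⟨hia, j, hj⟩; exact ⟨hia, j, by rw [hoff' i hia]; exact hj⟩
    rw [this]; exact hD1 v
  have h12 := shwLip_card_viol_le (g Φ) (g Φ') Φ Φ' a hoff D hD1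
  have h21 := shwLip_card_viol_le (g Φ') (g Φ) Φ' Φ a hoff' D hD2
  have hham' : (hammingDist (g Φ') (g Φ) : ℝ) ≤ K := by rw [hammingDist_comm]; exact hham
  have hDnn : (0 : ℝ) ≤ (D : ℝ) := Nat.cast_nonneg _
  have h12R : ((((univ : Finset (Fin m)).filter fun i => ∀ j, g Φ (Φ i j).1 ≠ (Φ i j).2).card : ℕ) : ℝ)
      ≤ ((((univ : Finset (Fin m)).filter fun i => ∀ j, g Φ' (Φ' i j).1 ≠ (Φ' i j).2).card : ℕ) : ℝ)
        + 1 + ((hammingDist (g Φ) (g Φ') : ℕ) : ℝ) * ((D : ℕ) : ℝ) := by exact_mod_cast h12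
  have h21R : ((((univ : Finset (Fin m)).filter fun i => ∀ j, g Φ' (Φ' i j).1 ≠ (Φ' i j).2).card : ℕ) : ℝ)
      ≤ ((((univ : Finset (Fin m)).filter fun i => ∀ j, g Φ (Φ i j).1 ≠ (Φ i j).2).card : ℕ) : ℝ)
        + 1 + ((hammingDist (g Φ') (g Φ) : ℕ) : ℝ) * ((D : ℕ) : ℝ) := by exact_mod_cast h21
  set V1 : ℝ := ((((univ : Finset (Fin m)).filter fun i => ∀ j, g Φ (Φ i j).1 ≠ (Φ i j).2).card : ℕ) : ℝ)
  set V2 : ℝ := ((((univ : Finset (Fin m)).filter fun i => ∀ j, g Φ' (Φ' i j).1 ≠ (Φ' i j).2).card : ℕ) : ℝ)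
  have hup : V1 - V2 ≤ 1 + K * D := by nlinarith [mul_le_mul_of_nonneg_right hham hDnn]
  have hdown : V2 - V1 ≤ 1 + K * D := by nlinarith [mul_le_mul_of_nonneg_right hham' hDnn]
  have habs : |V1 - V2| ≤ 1 + K * D := abs_sub_le_iff.2 ⟨hup, hdown⟩
  have hnn : 0 ≤ 1 + K * D := by positivity
  calc (V1 - V2) ^ 2 = |V1 - V2| ^ 2 := (sq_abs _).symm
    _ ≤ (1 + K * D) ^ 2 := pow_le_pow_left₀ (abs_nonneg _) habs 2

/-- The trivial bounded difference: both counts lie in `[0, m]`, so `(V_g Φ - V_g Φ')² ≤ m²`. -/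
theorem sissT_violated_diff_sq_le_trivial (g : (Fin m → Fin k → Fin n × Bool) → (Fin n → Bool))
    (Φ Φ' : Fin m → Fin k → Fin n × Bool) :
    ((((univ : Finset (Fin m)).filter fun i => ∀ j, g Φ (Φ i j).1 ≠ (Φ i j).2).card : ℝ)
      - (((univ : Finset (Fin m)).filter fun i => ∀ j, g Φ' (Φ' i j).1 ≠ (Φ' i j).2).card : ℝ)) ^ 2
      ≤ (m : ℝ) ^ 2 := by
  have h1 : ((((univ : Finset (Fin m)).filter fun i => ∀ j, g Φ (Φ i j).1 ≠ (Φ i j).2).card : ℕ) : ℝ)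
      ≤ m := by
    have := Finset.card_le_univ ((univ : Finset (Fin m)).filter fun i => ∀ j, g Φ (Φ i j).1 ≠ (Φ i j).2)
    rw [Fintype.card_fin] at this
    exact_mod_cast this
  have h2 : ((((univ : Finset (Fin m)).filter fun i => ∀ j, g Φ' (Φ' i j).1 ≠ (Φ' i j).2).card : ℕ) : ℝ)
      ≤ m := by
    have := Finset.card_le_univ ((univ : Finset (Fin m)).filter fun i => ∀ j, g Φ' (Φ' i j).1 ≠ (Φ' i j).2)
    rw [Fintype.card_fin] at this
    exact_mod_cast this
  have h1' : (0 : ℝ) ≤ ((((univ : Finset (Fin m)).filter fun i =>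
      ∀ j, g Φ (Φ i j).1 ≠ (Φ i j).2).card : ℕ) : ℝ) := Nat.cast_nonneg _
  have h2' : (0 : ℝ) ≤ ((((univ : Finset (Fin m)).filter fun i =>
      ∀ j, g Φ' (Φ' i j).1 ≠ (Φ' i j).2).card : ℕ) : ℝ) := Nat.cast_nonneg _
  have habs : |((((univ : Finset (Fin m)).filter fun i => ∀ j, g Φ (Φ i j).1 ≠ (Φ i j).2).card : ℕ) : ℝ)
      - ((((univ : Finset (Fin m)).filter fun i => ∀ j, g Φ' (Φ' i j).1 ≠ (Φ' i j).2).card : ℕ) : ℝ)|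
      ≤ m := abs_sub_le_iff.2 ⟨by linarith, by linarith⟩
  calc _ = |((((univ : Finset (Fin m)).filter fun i => ∀ j, g Φ (Φ i j).1 ≠ (Φ i j).2).card : ℕ) : ℝ)
      - ((((univ : Finset (Fin m)).filter fun i => ∀ j, g Φ' (Φ' i j).1 ≠ (Φ' i j).2).card : ℕ) : ℝ)| ^ 2 :=
        (sq_abs _).symm
    _ ≤ (m : ℝ) ^ 2 := pow_le_pow_left₀ (abs_nonneg _) habs 2

/-- **Variance of the violated-clause count of a typically-Lipschitz map (Efron–Stein with an
exceptional set).** For `1 ≤ n` and a map `g` that is `s`-Lipschitz per single-literal change at every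
instance of maximum clause-degree `≤ L + 1` (`0 ≤ s`):
`∑_Φ (V_g Φ - μ)² ≤ m · (#instances + k² s² · ∑_Φ D(Φ)² + m² · #{Φ : L < D Φ})`. -/
theorem sissT_sum_sq_dev_le (hn : 1 ≤ n) (g : (Fin m → Fin k → Fin n × Bool) → (Fin n → Bool))
    (s : ℝ) (hs : 0 ≤ s) (L : ℕ)
    (hg : ∀ (Φ : Fin m → Fin k → Fin n × Bool),
      ((univ : Finset (Fin n)).sup fun v =>
        ((univ : Finset (Fin m)).filter fun i => ∃ j, (Φ i j).1 = v).card) ≤ L + 1 →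
      ∀ (a : Fin m) (b : Fin k) (ℓ : Fin n × Bool),
        (hammingDist (g Φ) (g (Function.update Φ a (Function.update (Φ a) b ℓ))) : ℝ) ≤ s) :
    ∑ Φ : Fin m → Fin k → Fin n × Bool,
        ((((univ : Finset (Fin m)).filter fun i => ∀ j, g Φ (Φ i j).1 ≠ (Φ i j).2).card : ℝ)
          - (∑ Ψ : Fin m → Fin k → Fin n × Bool,
              (((univ : Finset (Fin m)).filter fun i => ∀ j, g Ψ (Ψ i j).1 ≠ (Ψ i j).2).card : ℝ))
            / Fintype.card (Fin m → Fin k → Fin n × Bool)) ^ 2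
      ≤ m * (Fintype.card (Fin m → Fin k → Fin n × Bool)
          + (k : ℝ) ^ 2 * s ^ 2 * ∑ Φ : Fin m → Fin k → Fin n × Bool,
              (((univ : Finset (Fin n)).sup fun v =>
                ((univ : Finset (Fin m)).filter fun i => ∃ j, (Φ i j).1 = v).card : ℕ) : ℝ) ^ 2
          + (m : ℝ) ^ 2 * (((univ : Finset (Fin m → Fin k → Fin n × Bool)).filter fun Φ =>
              L < (univ : Finset (Fin n)).sup fun v =>
                ((univ : Finset (Fin m)).filter fun i => ∃ j, (Φ i j).1 = v).card).card : ℝ)) := by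
  haveI : Nonempty (Fin k → Fin n × Bool) := ⟨fun _ => (⟨0, hn⟩, true)⟩
  set f : (Fin m → Fin k → Fin n × Bool) → ℝ := fun Φ =>
    (((univ : Finset (Fin m)).filter fun i => ∀ j, g Φ (Φ i j).1 ≠ (Φ i j).2).card : ℝ) with hf
  set Dn : (Fin m → Fin k → Fin n × Bool) → ℕ := fun Φ =>
    (univ : Finset (Fin n)).sup fun v =>
      ((univ : Finset (Fin m)).filter fun i => ∃ j, (Φ i j).1 = v).card with hDn
  set Dr : (Fin m → Fin k → Fin n × Bool) → ℝ := fun Φ => ((Dn Φ : ℕ) : ℝ) with hDr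
  have hES := Summit.PneNP.PneNP.Cruxes.SolvableImpliesStableSection.Sketch.es_efronStein
    (C := Fin k → Fin n × Bool) m f
  have hC : (0 : ℝ) < Fintype.card (Fin k → Fin n × Bool) := by
    exact_mod_cast Fintype.card_pos
  -- bound each squared difference, with the exceptional instances charged `m²`
  have hbd : ∀ (Φ : Fin m → Fin k → Fin n × Bool) (a : Fin m) (cl : Fin k → Fin n × Bool),
      (f Φ - f (Function.update Φ a cl)) ^ 2
        ≤ (1 + k * s * Dr Φ) ^ 2 + (m : ℝ) ^ 2 * (if L < Dn Φ then 1 else 0) := by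
    intro Φ a cl
    by_cases hL : L < Dn Φ
    · rw [if_pos hL, mul_one]
      have h1 : (f Φ - f (Function.update Φ a cl)) ^ 2 ≤ (m : ℝ) ^ 2 := by
        simp only [hf]
        exact sissT_violated_diff_sq_le_trivial g Φ (Function.update Φ a cl)
      have h2 : 0 ≤ (1 + k * s * Dr Φ) ^ 2 := sq_nonneg _
      linarith
    · rw [if_neg hL, mul_zero, add_zero]
      have hΦ : Dn Φ ≤ L := not_lt.1 hL
      have hham : (hammingDist (g Φ) (g (Function.update Φ a cl)) : ℝ) ≤ k * s :=
        sissT_hamming_clauseUpdate_le g s L hg Φ hΦ a cl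
      simp only [hf, hDr, hDn]
      exact sissT_violated_diff_sq_le_of_hamming g (k * s) (by positivity) Φ a cl hham
  have hRHS : (1 / 2 : ℝ) * ∑ a : Fin m, ∑ Φ : Fin m → Fin k → Fin n × Bool,
        ∑ cl : Fin k → Fin n × Bool, (f Φ - f (Function.update Φ a cl)) ^ 2
      ≤ (1 / 2 : ℝ) * (m * (Fintype.card (Fin k → Fin n × Bool) *
          ∑ Φ : Fin m → Fin k → Fin n × Bool,
            ((1 + k * s * Dr Φ) ^ 2 + (m : ℝ) ^ 2 * (if L < Dn Φ then 1 else 0)))) := by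
    refine mul_le_mul_of_nonneg_left ?_ (by norm_num)
    calc ∑ a : Fin m, ∑ Φ : Fin m → Fin k → Fin n × Bool,
          ∑ cl : Fin k → Fin n × Bool, (f Φ - f (Function.update Φ a cl)) ^ 2
        ≤ ∑ _a : Fin m, ∑ Φ : Fin m → Fin k → Fin n × Bool,
          ∑ _cl : Fin k → Fin n × Bool,
            ((1 + k * s * Dr Φ) ^ 2 + (m : ℝ) ^ 2 * (if L < Dn Φ then 1 else 0)) := by
          exact Finset.sum_le_sum fun a _ => Finset.sum_le_sum fun Φ _ =>
            Finset.sum_le_sum fun cl _ => hbd Φ a cl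
      _ = m * (Fintype.card (Fin k → Fin n × Bool) *
          ∑ Φ : Fin m → Fin k → Fin n × Bool,
            ((1 + k * s * Dr Φ) ^ 2 + (m : ℝ) ^ 2 * (if L < Dn Φ then 1 else 0))) := by
          simp only [Finset.sum_const, Finset.card_univ, Fintype.card_fin, nsmul_eq_mul, Finset.mul_sum]
  have hmain := hES.trans hRHS
  -- simplify (1 + x)² ≤ 2 (1 + x²) and sum the indicator
  have hsq : ∑ Φ : Fin m → Fin k → Fin n × Bool,
        ((1 + k * s * Dr Φ) ^ 2 + (m : ℝ) ^ 2 * (if L < Dn Φ then 1 else 0))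
      ≤ 2 * (Fintype.card (Fin m → Fin k → Fin n × Bool) + (k : ℝ) ^ 2 * s ^ 2 *
          ∑ Φ : Fin m → Fin k → Fin n × Bool, Dr Φ ^ 2
          + (m : ℝ) ^ 2 * (((univ : Finset (Fin m → Fin k → Fin n × Bool)).filter
              fun Φ => L < Dn Φ).card : ℝ)) := by
    calc ∑ Φ : Fin m → Fin k → Fin n × Bool,
          ((1 + k * s * Dr Φ) ^ 2 + (m : ℝ) ^ 2 * (if L < Dn Φ then 1 else 0))
        ≤ ∑ Φ : Fin m → Fin k → Fin n × Bool,
            ((2 + 2 * ((k : ℝ) ^ 2 * s ^ 2 * Dr Φ ^ 2)) + 2 * ((m : ℝ) ^ 2 * (if L < Dn Φ then 1 else 0))) :=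
          Finset.sum_le_sum fun Φ _ => by
            have h0 : 0 ≤ (m : ℝ) ^ 2 * (if L < Dn Φ then 1 else 0) := by
              split_ifs <;> positivity
            nlinarith [sq_nonneg (1 - k * s * Dr Φ), h0]
      _ = _ := by
          rw [Finset.sum_add_distrib, Finset.sum_add_distrib, Finset.sum_const, Finset.card_univ,
            nsmul_eq_mul, ← Finset.mul_sum, ← Finset.mul_sum, ← Finset.mul_sum, ← Finset.mul_sum,
            Finset.sum_boole]
          ring
  have hcancel : ∑ Φ : Fin m → Fin k → Fin n × Bool,
        (f Φ - (∑ Ψ, f Ψ) / Fintype.card (Fin m → Fin k → Fin n × Bool)) ^ 2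
      ≤ (1 / 2 : ℝ) * (m * ∑ Φ : Fin m → Fin k → Fin n × Bool,
          ((1 + k * s * Dr Φ) ^ 2 + (m : ℝ) ^ 2 * (if L < Dn Φ then 1 else 0))) := by
    have := hmain
    rw [show (1 / 2 : ℝ) * (m * (Fintype.card (Fin k → Fin n × Bool) *
        ∑ Φ : Fin m → Fin k → Fin n × Bool,
          ((1 + k * s * Dr Φ) ^ 2 + (m : ℝ) ^ 2 * (if L < Dn Φ then 1 else 0))))
        = (Fintype.card (Fin k → Fin n × Bool) : ℝ) *
          ((1 / 2 : ℝ) * (m * ∑ Φ : Fin m → Fin k → Fin n × Bool,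
            ((1 + k * s * Dr Φ) ^ 2 + (m : ℝ) ^ 2 * (if L < Dn Φ then 1 else 0)))) by ring]
      at this
    exact le_of_mul_le_mul_left this hC
  have hm0 : (0 : ℝ) ≤ m := Nat.cast_nonneg _
  calc _ = ∑ Φ : Fin m → Fin k → Fin n × Bool,
          (f Φ - (∑ Ψ, f Ψ) / Fintype.card (Fin m → Fin k → Fin n × Bool)) ^ 2 := by rfl
    _ ≤ (1 / 2 : ℝ) * (m * ∑ Φ : Fin m → Fin k → Fin n × Bool,
          ((1 + k * s * Dr Φ) ^ 2 + (m : ℝ) ^ 2 * (if L < Dn Φ then 1 else 0))) := hcancel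
    _ ≤ (1 / 2 : ℝ) * (m * (2 * (Fintype.card (Fin m → Fin k → Fin n × Bool) + (k : ℝ) ^ 2 * s ^ 2 *
          ∑ Φ : Fin m → Fin k → Fin n × Bool, Dr Φ ^ 2
          + (m : ℝ) ^ 2 * (((univ : Finset (Fin m → Fin k → Fin n × Bool)).filter
              fun Φ => L < Dn Φ).card : ℝ)))) := by gcongr
    _ = _ := by simp only [hDr, hDn]; ring

end TypLipschitz

end Summit.PneNP.PneNP.Theorems
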